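import Summits.KontsevichZagierPeriods.KontsevichZagierPeriods.Theorems.BetaCancellation.Negative.KernelForm
import Summits.KontsevichZagierPeriods.KontsevichZagierPeriods.Theorems.BetaCancellation.Negative.DirichletCompanionCharts
import Literature.NumberTheory.Transcendental.KZMellinFibres

/-!
# `BetaCancellation` (stmt-KontsevichZagierPeriods-13633) — line `dirichlet-companion-to-pi`: the two chart stubs hold

drefute (refuter, gen 2) certificate for the lead's reshaped skeleton (ce846a0b, 2026-08-16T02:03Z),
published next to the skeleton as the crux work file `Cruxes/BetaCancellation/DrefuteChartStubs.lean`
(importable module `Summits.KontsevichZagierPeriods.KontsevichZagierPeriods.Cruxes.BetaCancellation.DrefuteChartStubs`;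
namespace = module name, so nothing here collides with the disprover's `Disproof.lean` §15 or with a
later `Theorems/BetaCancellation/Negative/LineStubs.lean`).
The two remaining explicit stubs of the line are each ONE rule-(2) move of the Kontsevich–Zagier
calculus, and they are PROVED here token for token in the registered signatures:

* `stub_dirichletLinear_holds` — `[simplex, u^{ℓ-1} v^{m-1} (1-u-v)^{-m}] ∼ [box, t^{m-1}(1-t)^{-m} u^{ℓ-1}]`
  by the linear chart `Ψ(t,u) = (u, (1-u)t)` of the open box onto the open simplex
  (`linChart`, `|det Ψ'| = 1 - u`, `bFun_eq_jacobian`);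
* `stub_dirichletPolar_holds` — `[box, x^{ℓ+m-1}(1-x)^{-m} y^{ℓ-1}(1-y)^{m-1}] ∼ [simplex, …]`
  by the polar chart `Φ(x,y) = (xy, x(1-y))` (`polChart`, `|det Φ'| = x`, `pFun_eq_jacobian`),
  the simplex representation `simplexRep` being CONSTRUCTED (domain and integrand `ℚ`-semialgebraic
  as a Mellin datum `(X₀, X₁, 1-X₀-X₁)^{(ℓ-1, m-1, -m)}`; absolute integrability of Dirichlet's
  integrand transported from the box along `Ψ` by Mathlib's Jacobian criterion
  `integrableOn_image_iff_integrableOn_abs_det_fderiv_smul`).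

Consequences for the line: with `stub_betaTranslation` / `stub_integrateOut` (one Newton–Leibniz
move each, proved in the disprover's work file) all four explicit stubs are theorems, i.e. the
skeleton is an honest reduction `KZ.PiCancellation → EulerReflectionRational → BetaCancellation`;
the guards `0 < ℓ`, `0 < m`, `m < 1` are used only for the existence of `simplexRep`
(non-vacuity), never in the two moves themselves. Sorry-free; axioms ⊆ {propext, Classical.choice,
Quot.sound}. Template: `Theorems/MultiplicationThree/Negative/Pinned.lean`, `BoxToBox.lean`.
-/

noncomputable section

set_option linter.dupNamespace false

namespace Summit.KontsevichZagierPeriods.KontsevichZagierPeriods.Cruxes.BetaCancellation.DrefuteChartStubs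

open Summit.KontsevichZagierPeriods.KontsevichZagierPeriods.BetaCancellationNegative

open MeasureTheory Set
open Literature.NumberTheory.Transcendental
open Literature.NumberTheory.Transcendental.KZ
open Literature.ModelTheory.ExponentialFields (IsSemialgebraic)
open MvPolynomial (aeval X C)

/-! ## §1 The two domains -/

/-- The open box `(0,1)²`, literally the domain clause of the stubs. [folklore] -/
def dcBox : Set (Fin 2 → ℝ) := {z | z 0 ∈ Ioo (0:ℝ) 1 ∧ z 1 ∈ Ioo (0:ℝ) 1}

/-- The open simplex `{u > 0, v > 0, u + v < 1}`, literally the domain clause of the stubs. [folklore] -/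
def dcSimplex : Set (Fin 2 → ℝ) := {z | 0 < z 0 ∧ 0 < z 1 ∧ z 0 + z 1 < 1}

/-- The box in the `∀ j` spelling of `KZ.isSemialgebraic_box`. [folklore] -/
theorem dcBox_eq_forall : dcBox = {z : Fin 2 → ℝ | ∀ j, z j ∈ Ioo (0:ℝ) 1} := by
  ext z
  simp only [dcBox, mem_setOf_eq, Fin.forall_fin_two]

/-- The box is the product set `∏ (0,1)`. [folklore] -/
theorem dcBox_eq_pi : dcBox = Set.pi univ fun _ : Fin 2 => Ioo (0:ℝ) 1 := by
  ext z
  simp only [dcBox, mem_setOf_eq, mem_pi, mem_univ, true_implies, Fin.forall_fin_two]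

/-- The box is `ℚ`-semialgebraic. [folklore] -/
theorem isSemialgebraic_dcBox : IsSemialgebraic ℚ dcBox := by
  rw [dcBox_eq_forall]
  exact KZ.isSemialgebraic_box 2

/-- The box is Lebesgue measurable. [folklore] -/
theorem measurableSet_dcBox : MeasurableSet dcBox :=
  IsSemialgebraic.measurableSet_holds isSemialgebraic_dcBox

/-- The describing polynomials `(X₀, X₁, 1 - X₀ - X₁)` of the simplex (also the Mellin family of the
simplex integrand). [folklore] -/
def dcSimplexPolys : Fin 3 → MvPolynomial (Fin 2) ℚ := ![X 0, X 1, 1 - X 0 - X 1]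

/-- Values of the describing polynomials. [folklore] -/
@[simp] theorem aeval_dcSimplexPolys_zero (z : Fin 2 → ℝ) : aeval z (dcSimplexPolys 0) = z 0 := by
  simp [dcSimplexPolys]

/-- Values of the describing polynomials. [folklore] -/
@[simp] theorem aeval_dcSimplexPolys_one (z : Fin 2 → ℝ) : aeval z (dcSimplexPolys 1) = z 1 := by
  simp [dcSimplexPolys]

/-- Values of the describing polynomials. [folklore] -/
@[simp] theorem aeval_dcSimplexPolys_two (z : Fin 2 → ℝ) :
    aeval z (dcSimplexPolys 2) = 1 - z 0 - z 1 := by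
  simp [dcSimplexPolys]

/-- The simplex is cut out by `dcSimplexPolys > 0`. [folklore] -/
theorem dcSimplex_eq : dcSimplex = {z | ∀ l, 0 < aeval z (dcSimplexPolys l)} := by
  ext z
  simp only [dcSimplex, mem_setOf_eq, Fin.forall_fin_succ, Fin.succ_zero_eq_one, Fin.succ_one_eq_two,
    aeval_dcSimplexPolys_zero, aeval_dcSimplexPolys_one, aeval_dcSimplexPolys_two, IsEmpty.forall_iff,
    and_true]
  constructor
  · rintro ⟨h0, h1, h2⟩; exact ⟨h0, h1, by linarith⟩
  · rintro ⟨h0, h1, h2⟩; exact ⟨h0, h1, by linarith⟩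

/-- The simplex is `ℚ`-semialgebraic. [folklore] -/
theorem isSemialgebraic_dcSimplex : IsSemialgebraic ℚ dcSimplex := by
  rw [dcSimplex_eq]
  exact isSemialgebraic_setOf_forall_aeval_pos _

/-- The simplex is Lebesgue measurable. [folklore] -/
theorem measurableSet_dcSimplex : MeasurableSet dcSimplex :=
  IsSemialgebraic.measurableSet_holds isSemialgebraic_dcSimplex

/-! ## §2 The three integrands of the stubs -/

/-- The simplex integrand `u^{ℓ-1} v^{m-1} (1-u-v)^{-m}` of `S`, literally. [folklore] -/
def sFun (ℓ m : ℚ) : (Fin 2 → ℝ) → ℝ := fun z =>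
  (z 0) ^ ((ℓ:ℝ) - 1) * (z 1) ^ ((m:ℝ) - 1) * (1 - z 0 - z 1) ^ (-(m:ℝ))

/-- The box integrand `t^{m-1}(1-t)^{-m} u^{ℓ-1}` of `B`, literally. [folklore] -/
def bFun (ℓ m : ℚ) : (Fin 2 → ℝ) → ℝ := fun z =>
  (z 0) ^ ((m:ℝ) - 1) * (1 - z 0) ^ (-(m:ℝ)) * (z 1) ^ ((ℓ:ℝ) - 1)

/-- The box integrand `x^{ℓ+m-1}(1-x)^{-m} · y^{ℓ-1}(1-y)^{m-1}` of `P`, literally. [folklore] -/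
def pFun (ℓ m : ℚ) : (Fin 2 → ℝ) → ℝ := fun z =>
  (z 0) ^ ((ℓ:ℝ) + m - 1) * (1 - z 0) ^ (-(m:ℝ)) * ((z 1) ^ ((ℓ:ℝ) - 1) * (1 - z 1) ^ ((m:ℝ) - 1))

/-- The Mellin exponents `(ℓ-1, m-1, -m)` of the simplex integrand. [folklore] -/
def sExps (ℓ m : ℚ) : Fin 3 → ℚ := ![ℓ - 1, m - 1, -m]

/-- The simplex integrand is the Euler–Mellin integrand of `(dcSimplexPolys, sExps, 1)`. [folklore] -/
theorem sFun_eq_mellinIntegrand (ℓ m : ℚ) (z : Fin 2 → ℝ) :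
    sFun ℓ m z = mellinIntegrand dcSimplexPolys (sExps ℓ m) 1 z := by
  simp only [sFun, mellinIntegrand, Fin.prod_univ_three, sExps, Matrix.cons_val_zero, Matrix.cons_val_one,
    Matrix.cons_val_two, Matrix.head_cons, Matrix.tail_cons, aeval_dcSimplexPolys_zero,
    aeval_dcSimplexPolys_one, aeval_dcSimplexPolys_two, Rat.cast_one, one_mul, Rat.cast_sub, Rat.cast_neg]

/-- The simplex integrand is `ℚ`-semialgebraic on the simplex (rational exponents, positive bases).
[folklore] -/
theorem isSemialgebraicFunOn_sFun (ℓ m : ℚ) : IsSemialgebraicFunOn ℚ dcSimplex (sFun ℓ m) := by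
  refine (isSemialgebraicFunOn_mellinIntegrand isSemialgebraic_dcSimplex dcSimplexPolys (sExps ℓ m) 1
    ?_).congr fun z _ => (sFun_eq_mellinIntegrand ℓ m z).symm
  intro z hz l
  rw [dcSimplex_eq] at hz
  exact hz l

/-! ## §3 The linear chart `Ψ(t,u) = (u, (1-u)t)` of the simplex by the box -/

/-- The linear chart `Ψ(t, u) = (u, (1 - u)t)`. [folklore] -/
def linChart (z : Fin 2 → ℝ) : Fin 2 → ℝ := ![z 1, (1 - z 1) * z 0]

/-- First component of the linear chart. [folklore] -/
@[simp] theorem linChart_apply_zero (z : Fin 2 → ℝ) : linChart z 0 = z 1 := rfl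

/-- Second component of the linear chart. [folklore] -/
@[simp] theorem linChart_apply_one (z : Fin 2 → ℝ) : linChart z 1 = (1 - z 1) * z 0 := rfl

/-- The Jacobian matrix of the linear chart. [folklore] -/
def linJac (z : Fin 2 → ℝ) : Matrix (Fin 2) (Fin 2) ℝ := !![0, 1; 1 - z 1, -(z 0)]

/-- The derivative of the linear chart as a continuous linear map. [folklore] -/
def linChart' (z : Fin 2 → ℝ) : (Fin 2 → ℝ) →L[ℝ] (Fin 2 → ℝ) :=
  LinearMap.toContinuousLinearMap (Matrix.toLin' (linJac z))

/-- The derivative applied to a vector, first component. [folklore] -/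
@[simp] theorem linChart'_apply_zero (z v : Fin 2 → ℝ) : linChart' z v 0 = v 1 := by
  change Matrix.toLin' (linJac z) v 0 = _
  rw [Matrix.toLin'_apply]
  simp [linJac, Matrix.mulVec, dotProduct, Fin.sum_univ_two]

/-- The derivative applied to a vector, second component. [folklore] -/
@[simp] theorem linChart'_apply_one (z v : Fin 2 → ℝ) :
    linChart' z v 1 = (1 - z 1) * v 0 + -(z 0) * v 1 := by
  change Matrix.toLin' (linJac z) v 1 = _
  rw [Matrix.toLin'_apply]
  simp [linJac, Matrix.mulVec, dotProduct, Fin.sum_univ_two]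

/-- `det DΨ(t,u) = -(1 - u)`. [folklore] -/
theorem det_linChart' (z : Fin 2 → ℝ) : (linChart' z).det = -(1 - z 1) := by
  change LinearMap.det (Matrix.toLin' (linJac z)) = _
  rw [LinearMap.det_toLin', Matrix.det_fin_two]
  simp [linJac]

/-- The linear chart is differentiable with derivative `linChart'`. [folklore] -/
theorem hasFDerivAt_linChart (z : Fin 2 → ℝ) : HasFDerivAt linChart (linChart' z) z := by
  have h0 : HasFDerivAt (fun y : Fin 2 → ℝ => y 0)
      (ContinuousLinearMap.proj (R := ℝ) (φ := fun _ : Fin 2 => ℝ) 0) z :=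
    hasFDerivAt_apply 0 z
  have h1 : HasFDerivAt (fun y : Fin 2 → ℝ => y 1)
      (ContinuousLinearMap.proj (R := ℝ) (φ := fun _ : Fin 2 => ℝ) 1) z :=
    hasFDerivAt_apply 1 z
  rw [hasFDerivAt_pi']
  refine Fin.forall_fin_two.mpr ⟨?_, ?_⟩
  · have hf : (fun y : Fin 2 → ℝ => linChart y 0) = fun y => y 1 := funext fun y => rfl
    rw [hf]
    refine h1.congr_fderiv (ContinuousLinearMap.ext fun v => ?_)
    simp
  · have hf : (fun y : Fin 2 → ℝ => linChart y 1) = fun y => (1 - y 1) * y 0 := funext fun y => rfl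
    rw [hf]
    refine ((h1.const_sub 1).mul h0).congr_fderiv (ContinuousLinearMap.ext fun v => ?_)
    simp [mul_comm]

/-- The linear chart is injective on the box. [folklore] -/
theorem injOn_linChart : InjOn linChart dcBox := by
  intro x hx y hy hxy
  have h1 : x 1 = y 1 := by
    have := congrFun hxy 0
    simpa only [linChart_apply_zero] using this
  have h0 : x 0 = y 0 := by
    have := congrFun hxy 1
    simp only [linChart_apply_one, h1] at this
    have hne : (1 : ℝ) - y 1 ≠ 0 := by have := hy.2.2; linarith
    exact mul_left_cancel₀ hne this
  funext i
  fin_cases i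
  · exact h0
  · exact h1

/-- The linear chart maps the box ONTO the simplex. [folklore] -/
theorem image_linChart_dcBox : linChart '' dcBox = dcSimplex := by
  ext w
  constructor
  · rintro ⟨z, ⟨h0, h1⟩, rfl⟩
    refine ⟨by simpa using h1.1, by simp; exact mul_pos (by linarith [h1.2]) h0.1, ?_⟩
    simp only [linChart_apply_zero, linChart_apply_one]
    nlinarith [h0.1, h0.2, h1.1, h1.2, mul_pos (sub_pos.2 h1.2) (sub_pos.2 h0.2)]
  · rintro ⟨hw0, hw1, hw2⟩
    have h3 : 0 < 1 - w 0 := by linarith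
    refine ⟨![w 1 / (1 - w 0), w 0], ⟨?_, ?_⟩, ?_⟩
    · change w 1 / (1 - w 0) ∈ Ioo (0:ℝ) 1
      exact ⟨div_pos hw1 h3, by rw [div_lt_one h3]; linarith⟩
    · change w 0 ∈ Ioo (0:ℝ) 1
      exact ⟨hw0, by linarith⟩
    · funext i
      fin_cases i
      · rfl
      · change (1 - w 0) * (w 1 / (1 - w 0)) = w 1
        field_simp

/-- `|det DΨ| = 1 - u > 0` on the box. [folklore] -/
theorem abs_det_linChart' {z : Fin 2 → ℝ} (hz : z ∈ dcBox) : |(linChart' z).det| = 1 - z 1 := by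
  rw [det_linChart', abs_neg, abs_of_pos]
  have := hz.2.2
  linarith

/-- **The pull-back identity of the linear chart**: on the box, `bFun = (sFun ∘ Ψ) · |det DΨ|`
(`DirichletCompanionCharts.pullback_linear`). [folklore] -/
theorem bFun_eq_jacobian (ℓ m : ℚ) {z : Fin 2 → ℝ} (hz : z ∈ dcBox) :
    bFun ℓ m z = sFun ℓ m (linChart z) * |(linChart' z).det| := by
  rw [abs_det_linChart' hz]
  simp only [bFun, sFun, linChart_apply_zero, linChart_apply_one]
  exact (pullback_linear (ℓ:ℝ) (m:ℝ) hz.1.1 hz.1.2 hz.2.2).symm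

/-- The substitution polynomials of the linear chart. [folklore] -/
def linSubst : Fin 2 → MvPolynomial (Fin 2) ℚ := ![X 1, (1 - X 1) * X 0]

/-- Evaluating the substitution is the chart. [folklore] -/
theorem aeval_linSubst (z : Fin 2 → ℝ) : (fun i => aeval z (linSubst i)) = linChart z := by
  funext i
  fin_cases i
  · simp [linSubst]
  · simp [linSubst]

/-- The linear chart is a `ℚ`-semialgebraic map on the box (a polynomial map). [folklore] -/
theorem isSemialgebraicMapOn_linChart : IsSemialgebraicMapOn ℚ dcBox linChart := by
  convert isSemialgebraicMapOn_aeval isSemialgebraic_dcBox linSubst using 2 with z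
  exact (aeval_linSubst z).symm

/-! ## §4 Integrability: the box integrand of `B`, and Dirichlet's integrand on the simplex -/

/-- Lebesgue measure restricted to the box is the product of the restricted measures. [folklore] -/
theorem volume_restrict_dcBox :
    (volume : Measure (Fin 2 → ℝ)).restrict dcBox =
      Measure.pi fun _ : Fin 2 => (volume : Measure ℝ).restrict (Ioo (0:ℝ) 1) := by
  rw [dcBox_eq_pi, volume_pi, Measure.restrict_pi_pi]

/-- The one-variable factors `t^{m-1}(1-t)^{-m}`, `u^{ℓ-1}` of the box integrand of `B`. [folklore] -/
def bFactor (ℓ m : ℚ) : Fin 2 → ℝ → ℝ :=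
  ![fun t => t ^ ((m:ℝ) - 1) * (1 - t) ^ (-(m:ℝ)), fun u => u ^ ((ℓ:ℝ) - 1)]

/-- The box integrand of `B` is the product of its factors. [folklore] -/
theorem bFun_eq_prod (ℓ m : ℚ) (z : Fin 2 → ℝ) : bFun ℓ m z = ∏ i, bFactor ℓ m i (z i) := by
  simp only [bFun, bFactor, Fin.prod_univ_two, Matrix.cons_val_zero, Matrix.cons_val_one]

/-- Each factor is a Beta kernel, integrable on `(0,1)` for `0 < ℓ`, `0 < m < 1`
(`β(m, 1-m)` and `β(ℓ, 1)`). [folklore] -/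
theorem integrable_bFactor {ℓ m : ℚ} (hℓ : 0 < ℓ) (hm : 0 < m) (hm1 : m < 1) (i : Fin 2) :
    Integrable (bFactor ℓ m i) ((volume : Measure ℝ).restrict (Ioo (0:ℝ) 1)) := by
  fin_cases i
  · have h := (integrableOn_betaKernel_and_integral_eq hm (sub_pos.2 hm1)).1
    refine h.congr_fun (fun t _ => ?_) measurableSet_Ioo
    have e : (((1 - m : ℚ) : ℝ) - 1) = -(m:ℝ) := by push_cast; ring
    simp only [betaKernel, bFactor, Fin.zero_eta, Matrix.cons_val_zero, e]
  · have h := (integrableOn_betaKernel_and_integral_eq hℓ one_pos).1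
    refine h.congr_fun (fun t _ => ?_) measurableSet_Ioo
    simp only [betaKernel, bFactor, Fin.mk_one, Matrix.cons_val_one, Matrix.cons_val_fin_one,
      Rat.cast_one, sub_self, Real.rpow_zero, mul_one]

/-- The box integrand of `B` is absolutely integrable on the box. [folklore] -/
theorem integrableOn_bFun {ℓ m : ℚ} (hℓ : 0 < ℓ) (hm : 0 < m) (hm1 : m < 1) :
    IntegrableOn (bFun ℓ m) dcBox := by
  rw [IntegrableOn, volume_restrict_dcBox]
  have h := Integrable.fintype_prod (f := bFactor ℓ m)
    (μ := fun _ : Fin 2 => (volume : Measure ℝ).restrict (Ioo (0:ℝ) 1)) (integrable_bFactor hℓ hm hm1)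
  exact h.congr (ae_of_all _ fun z => (bFun_eq_prod ℓ m z).symm)

/-- **Dirichlet's integrand is absolutely integrable on the simplex** for `0 < ℓ`, `0 < m < 1`
(transport from the box along the linear chart by Mathlib's Jacobian criterion). [folklore] -/
theorem integrableOn_sFun {ℓ m : ℚ} (hℓ : 0 < ℓ) (hm : 0 < m) (hm1 : m < 1) :
    IntegrableOn (sFun ℓ m) dcSimplex := by
  rw [← image_linChart_dcBox]
  rw [integrableOn_image_iff_integrableOn_abs_det_fderiv_smul volume measurableSet_dcBox
    (fun z _ => (hasFDerivAt_linChart z).hasFDerivWithinAt) injOn_linChart]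
  refine (integrableOn_bFun hℓ hm hm1).congr_fun (fun z hz => ?_) measurableSet_dcBox
  rw [smul_eq_mul, bFun_eq_jacobian ℓ m hz, mul_comm]

/-! ## §5 The simplex representation (non-vacuity of `stub_dirichletLinear`, the `∃` of `stub_dirichletPolar`) -/

/-- **The simplex representation** `S = [ {u>0, v>0, u+v<1}, u^{ℓ-1} v^{m-1} (1-u-v)^{-m} ]` for
`0 < ℓ`, `0 < m < 1`: an admissible integral representation (domain and integrand
`ℚ`-semialgebraic, absolutely convergent). [folklore] -/
def simplexRep (ℓ m : ℚ) (hℓ : 0 < ℓ) (hm : 0 < m) (hm1 : m < 1) : IntegralRep 2 where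
  domain := dcSimplex
  integrand := sFun ℓ m
  isSemialgebraic_domain := isSemialgebraic_dcSimplex
  isSemialgebraicFunOn_integrand := isSemialgebraicFunOn_sFun ℓ m
  integrableOn := integrableOn_sFun hℓ hm hm1

/-- The domain of `simplexRep`. [folklore] -/
@[simp] theorem simplexRep_domain (ℓ m : ℚ) (hℓ : 0 < ℓ) (hm : 0 < m) (hm1 : m < 1) :
    (simplexRep ℓ m hℓ hm hm1).domain = dcSimplex := rfl

/-- The integrand of `simplexRep`. [folklore] -/
@[simp] theorem simplexRep_integrand (ℓ m : ℚ) (hℓ : 0 < ℓ) (hm : 0 < m) (hm1 : m < 1) :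
    (simplexRep ℓ m hℓ hm hm1).integrand = sFun ℓ m := rfl

/-! ## §6 `stub_dirichletLinear` holds: ONE rule-(2) move -/

/-- **The linear chart is ONE rule-(2) move**: for any `B` pinned on the box with integrand `bFun`
and any `S` pinned on the simplex with integrand `sFun`, `[B] − [S] ∈ KZ.changeOfVariablesRel`.
No hypothesis on `ℓ`, `m` is needed here. [cite: KontsevichZagier2001, §1.2 rule (2)] -/
theorem of_sub_of_mem_changeOfVariablesRel_linChart (ℓ m : ℚ) (S B : IntegralRep 2)
    (hSd : S.domain = dcSimplex) (hSi : EqOn S.integrand (sFun ℓ m) S.domain)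
    (hBd : B.domain = dcBox) (hBi : EqOn B.integrand (bFun ℓ m) B.domain) :
    of B - of S ∈ changeOfVariablesRel := by
  refine ⟨2, B, S, linChart, linChart', ?_, fun z _ => (hasFDerivAt_linChart z).hasFDerivWithinAt,
    ?_, ?_, fun z hz => ?_, rfl⟩
  · rw [hBd]; exact isSemialgebraicMapOn_linChart
  · rw [hBd]; exact injOn_linChart
  · rw [hBd, hSd, image_linChart_dcBox]
  · rw [hBd] at hz
    have hz' : linChart z ∈ S.domain := by
      rw [hSd, ← image_linChart_dcBox]; exact mem_image_of_mem _ hz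
    rw [hBi (hBd ▸ hz), hSi hz']
    exact bFun_eq_jacobian ℓ m hz

/-- **`stub_dirichletLinear` of line `dirichlet-companion-to-pi` HOLDS** (registered signature,
verbatim): the linear chart `(t,u) ↦ (u, (1-u)t)` of the box onto the open simplex is one rule-(2)
move `[simplex, u^{ℓ-1} v^{m-1} (1-u-v)^{-m}] ∼ [box, t^{m-1}(1-t)^{-m} u^{ℓ-1}]`. The guards are not
used. [folklore] -/
theorem stub_dirichletLinear_holds : ∀ (ℓ m : ℚ), 0 < ℓ → 0 < m → m < 1 →
    ∀ (S B : Literature.NumberTheory.Transcendental.KZ.IntegralRep 2),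
    S.domain = {z | 0 < z 0 ∧ 0 < z 1 ∧ z 0 + z 1 < 1} →
    Set.EqOn S.integrand (fun z => (z 0) ^ ((ℓ:ℝ) - 1) * (z 1) ^ ((m:ℝ) - 1) *
      (1 - z 0 - z 1) ^ (-(m:ℝ))) S.domain →
    B.domain = {z | z 0 ∈ Set.Ioo (0:ℝ) 1 ∧ z 1 ∈ Set.Ioo (0:ℝ) 1} →
    Set.EqOn B.integrand (fun z => (z 0) ^ ((m:ℝ) - 1) * (1 - z 0) ^ (-(m:ℝ)) *
      (z 1) ^ ((ℓ:ℝ) - 1)) B.domain →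
    Literature.NumberTheory.Transcendental.KZ.Equivalent S B := by
  intro ℓ m _ _ _ S B hSd hSi hBd hBi
  have h : Equivalent B S := changeOfVariablesRel_subset_relations
    (of_sub_of_mem_changeOfVariablesRel_linChart ℓ m S B hSd hSi hBd hBi)
  exact h.symm

/-! ## §7 The polar chart `Φ(x,y) = (xy, x(1-y))` of the simplex by the box -/

/-- The polar chart `Φ(x, y) = (xy, x(1 - y))`. [folklore] -/
def polChart (z : Fin 2 → ℝ) : Fin 2 → ℝ := ![z 0 * z 1, z 0 * (1 - z 1)]

/-- First component of the polar chart. [folklore] -/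
@[simp] theorem polChart_apply_zero (z : Fin 2 → ℝ) : polChart z 0 = z 0 * z 1 := rfl

/-- Second component of the polar chart. [folklore] -/
@[simp] theorem polChart_apply_one (z : Fin 2 → ℝ) : polChart z 1 = z 0 * (1 - z 1) := rfl

/-- The Jacobian matrix of the polar chart. [folklore] -/
def polJac (z : Fin 2 → ℝ) : Matrix (Fin 2) (Fin 2) ℝ := !![z 1, z 0; 1 - z 1, -(z 0)]

/-- The derivative of the polar chart as a continuous linear map. [folklore] -/
def polChart' (z : Fin 2 → ℝ) : (Fin 2 → ℝ) →L[ℝ] (Fin 2 → ℝ) :=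
  LinearMap.toContinuousLinearMap (Matrix.toLin' (polJac z))

/-- The derivative applied to a vector, first component. [folklore] -/
@[simp] theorem polChart'_apply_zero (z v : Fin 2 → ℝ) : polChart' z v 0 = z 1 * v 0 + z 0 * v 1 := by
  change Matrix.toLin' (polJac z) v 0 = _
  rw [Matrix.toLin'_apply]
  simp [polJac, Matrix.mulVec, dotProduct, Fin.sum_univ_two]

/-- The derivative applied to a vector, second component. [folklore] -/
@[simp] theorem polChart'_apply_one (z v : Fin 2 → ℝ) :
    polChart' z v 1 = (1 - z 1) * v 0 + -(z 0) * v 1 := by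
  change Matrix.toLin' (polJac z) v 1 = _
  rw [Matrix.toLin'_apply]
  simp [polJac, Matrix.mulVec, dotProduct, Fin.sum_univ_two]

/-- `det DΦ(x,y) = -x`. [folklore] -/
theorem det_polChart' (z : Fin 2 → ℝ) : (polChart' z).det = -(z 0) := by
  change LinearMap.det (Matrix.toLin' (polJac z)) = _
  rw [LinearMap.det_toLin', Matrix.det_fin_two]
  simp [polJac]
  ring

/-- The polar chart is differentiable with derivative `polChart'`. [folklore] -/
theorem hasFDerivAt_polChart (z : Fin 2 → ℝ) : HasFDerivAt polChart (polChart' z) z := by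
  have h0 : HasFDerivAt (fun y : Fin 2 → ℝ => y 0)
      (ContinuousLinearMap.proj (R := ℝ) (φ := fun _ : Fin 2 => ℝ) 0) z :=
    hasFDerivAt_apply 0 z
  have h1 : HasFDerivAt (fun y : Fin 2 → ℝ => y 1)
      (ContinuousLinearMap.proj (R := ℝ) (φ := fun _ : Fin 2 => ℝ) 1) z :=
    hasFDerivAt_apply 1 z
  rw [hasFDerivAt_pi']
  refine Fin.forall_fin_two.mpr ⟨?_, ?_⟩
  · have hf : (fun y : Fin 2 → ℝ => polChart y 0) = fun y => y 0 * y 1 := funext fun y => rfl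
    rw [hf]
    refine (h0.mul h1).congr_fderiv (ContinuousLinearMap.ext fun v => ?_)
    simp
    ring
  · have hf : (fun y : Fin 2 → ℝ => polChart y 1) = fun y => y 0 * (1 - y 1) := funext fun y => rfl
    rw [hf]
    refine (h0.mul (h1.const_sub 1)).congr_fderiv (ContinuousLinearMap.ext fun v => ?_)
    simp
    ring

/-- The polar chart is injective on the box. [folklore] -/
theorem injOn_polChart : InjOn polChart dcBox := by
  intro x hx y hy hxy
  have e0 := congrFun hxy 0
  have e1 := congrFun hxy 1
  simp only [polChart_apply_zero, polChart_apply_one] at e0 e1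
  have h0 : x 0 = y 0 := by linarith
  have h1 : x 1 = y 1 := by
    rw [h0] at e0
    exact mul_left_cancel₀ hy.1.1.ne' e0
  funext i
  fin_cases i
  · exact h0
  · exact h1

/-- The polar chart maps the box ONTO the simplex (inverse `x = u + v`, `y = u/(u+v)`). [folklore] -/
theorem image_polChart_dcBox : polChart '' dcBox = dcSimplex := by
  ext w
  constructor
  · rintro ⟨z, ⟨h0, h1⟩, rfl⟩
    refine ⟨mul_pos h0.1 h1.1, mul_pos h0.1 (by linarith [h1.2]), ?_⟩
    simp only [polChart_apply_zero, polChart_apply_one]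
    nlinarith [h0.1, h0.2, h1.1, h1.2]
  · rintro ⟨hw0, hw1, hw2⟩
    have hs : 0 < w 0 + w 1 := by linarith
    refine ⟨![w 0 + w 1, w 0 / (w 0 + w 1)], ⟨?_, ?_⟩, ?_⟩
    · change w 0 + w 1 ∈ Ioo (0:ℝ) 1
      exact ⟨hs, hw2⟩
    · change w 0 / (w 0 + w 1) ∈ Ioo (0:ℝ) 1
      exact ⟨div_pos hw0 hs, by rw [div_lt_one hs]; linarith⟩
    · funext i
      fin_cases i
      · change (w 0 + w 1) * (w 0 / (w 0 + w 1)) = w 0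
        field_simp
      · change (w 0 + w 1) * (1 - w 0 / (w 0 + w 1)) = w 1
        field_simp
        ring

/-- `|det DΦ| = x > 0` on the box. [folklore] -/
theorem abs_det_polChart' {z : Fin 2 → ℝ} (hz : z ∈ dcBox) : |(polChart' z).det| = z 0 := by
  rw [det_polChart', abs_neg, abs_of_pos hz.1.1]

/-- **The pull-back identity of the polar chart**: on the box, `pFun = (sFun ∘ Φ) · |det DΦ|`
(`DirichletCompanionCharts.pullback_polar`). [folklore] -/
theorem pFun_eq_jacobian (ℓ m : ℚ) {z : Fin 2 → ℝ} (hz : z ∈ dcBox) :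
    pFun ℓ m z = sFun ℓ m (polChart z) * |(polChart' z).det| := by
  rw [abs_det_polChart' hz]
  simp only [pFun, sFun, polChart_apply_zero, polChart_apply_one]
  exact (pullback_polar (ℓ:ℝ) (m:ℝ) hz.1.1 hz.2.1 hz.2.2).symm

/-- The substitution polynomials of the polar chart. [folklore] -/
def polSubst : Fin 2 → MvPolynomial (Fin 2) ℚ := ![X 0 * X 1, X 0 * (1 - X 1)]

/-- Evaluating the substitution is the chart. [folklore] -/
theorem aeval_polSubst (z : Fin 2 → ℝ) : (fun i => aeval z (polSubst i)) = polChart z := by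
  funext i
  fin_cases i
  · simp [polSubst]
  · simp [polSubst]

/-- The polar chart is a `ℚ`-semialgebraic map on the box (a polynomial map). [folklore] -/
theorem isSemialgebraicMapOn_polChart : IsSemialgebraicMapOn ℚ dcBox polChart := by
  convert isSemialgebraicMapOn_aeval isSemialgebraic_dcBox polSubst using 2 with z
  exact (aeval_polSubst z).symm

/-! ## §8 `stub_dirichletPolar` holds: the simplex representation and ONE rule-(2) move -/

/-- **The polar chart is ONE rule-(2) move**: for any `P` pinned on the box with integrand `pFun`
and any `S` pinned on the simplex with integrand `sFun`, `[P] − [S] ∈ KZ.changeOfVariablesRel`.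
No hypothesis on `ℓ`, `m` is needed here. [cite: KontsevichZagier2001, §1.2 rule (2)] -/
theorem of_sub_of_mem_changeOfVariablesRel_polChart (ℓ m : ℚ) (P S : IntegralRep 2)
    (hPd : P.domain = dcBox) (hPi : EqOn P.integrand (pFun ℓ m) P.domain)
    (hSd : S.domain = dcSimplex) (hSi : EqOn S.integrand (sFun ℓ m) S.domain) :
    of P - of S ∈ changeOfVariablesRel := by
  refine ⟨2, P, S, polChart, polChart', ?_, fun z _ => (hasFDerivAt_polChart z).hasFDerivWithinAt,
    ?_, ?_, fun z hz => ?_, rfl⟩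
  · rw [hPd]; exact isSemialgebraicMapOn_polChart
  · rw [hPd]; exact injOn_polChart
  · rw [hPd, hSd, image_polChart_dcBox]
  · rw [hPd] at hz
    have hz' : polChart z ∈ S.domain := by
      rw [hSd, ← image_polChart_dcBox]; exact mem_image_of_mem _ hz
    rw [hPi (hPd ▸ hz), hSi hz']
    exact pFun_eq_jacobian ℓ m hz

/-- **`stub_dirichletPolar` of line `dirichlet-companion-to-pi` HOLDS** (registered signature,
verbatim): the simplex representation exists (`simplexRep`, using `0 < ℓ`, `0 < m < 1` for
absolute convergence only) and the polar chart `(x,y) ↦ (xy, x(1-y))` of the box onto the open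
simplex is one rule-(2) move
`[box, x^{ℓ+m-1}(1-x)^{-m} y^{ℓ-1}(1-y)^{m-1}] ∼ [simplex, u^{ℓ-1} v^{m-1} (1-u-v)^{-m}]`. [folklore] -/
theorem stub_dirichletPolar_holds : ∀ (ℓ m : ℚ), 0 < ℓ → 0 < m → m < 1 →
    ∀ (P : Literature.NumberTheory.Transcendental.KZ.IntegralRep 2),
    P.domain = {z | z 0 ∈ Set.Ioo (0:ℝ) 1 ∧ z 1 ∈ Set.Ioo (0:ℝ) 1} →
    Set.EqOn P.integrand (fun z => (z 0) ^ ((ℓ:ℝ) + m - 1) * (1 - z 0) ^ (-(m:ℝ)) *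
      ((z 1) ^ ((ℓ:ℝ) - 1) * (1 - z 1) ^ ((m:ℝ) - 1))) P.domain →
    ∃ S : Literature.NumberTheory.Transcendental.KZ.IntegralRep 2,
      S.domain = {z | 0 < z 0 ∧ 0 < z 1 ∧ z 0 + z 1 < 1} ∧
      Set.EqOn S.integrand (fun z => (z 0) ^ ((ℓ:ℝ) - 1) * (z 1) ^ ((m:ℝ) - 1) *
        (1 - z 0 - z 1) ^ (-(m:ℝ))) S.domain ∧
      Literature.NumberTheory.Transcendental.KZ.Equivalent P S := by
  intro ℓ m hℓ hm hm1 P hPd hPi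
  refine ⟨simplexRep ℓ m hℓ hm hm1, rfl, fun _ _ => rfl, ?_⟩
  exact changeOfVariablesRel_subset_relations
    (of_sub_of_mem_changeOfVariablesRel_polChart ℓ m P (simplexRep ℓ m hℓ hm hm1) hPd hPi rfl
      (fun _ _ => rfl))

/-! ## §9 The composite `P ∼ B` of the two charts (the Dirichlet re-association, value
`B(ℓ+m,1-m)·B(ℓ,m) = B(m,1-m)·B(ℓ,1)`), unconditionally in the moves -/

/-- **Dirichlet re-association in two moves**: any `P` pinned on the box with integrand
`x^{ℓ+m-1}(1-x)^{-m} y^{ℓ-1}(1-y)^{m-1}` is equivalent to any `B` pinned on the box with integrand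
`t^{m-1}(1-t)^{-m} u^{ℓ-1}` (`0 < ℓ`, `0 < m < 1`): polar chart onto the simplex, linear chart back.
[folklore] -/
theorem equivalent_of_pinned_pFun_bFun {ℓ m : ℚ} (hℓ : 0 < ℓ) (hm : 0 < m) (hm1 : m < 1)
    (P B : IntegralRep 2) (hPd : P.domain = dcBox) (hPi : EqOn P.integrand (pFun ℓ m) P.domain)
    (hBd : B.domain = dcBox) (hBi : EqOn B.integrand (bFun ℓ m) B.domain) : Equivalent P B := by
  obtain ⟨S, hSd, hSi, hPS⟩ := stub_dirichletPolar_holds ℓ m hℓ hm hm1 P hPd hPi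
  exact hPS.trans (stub_dirichletLinear_holds ℓ m hℓ hm hm1 S B hSd hSi hBd hBi)

end Summit.KontsevichZagierPeriods.KontsevichZagierPeriods.Cruxes.BetaCancellation.DrefuteChartStubs
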